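import Summits.RiemannHypothesis.RiemannHypothesis.Theorems.WeilColumnBSplineCDF
import HarnessLib

/-!
# B-spline scaling: `bsplineDensity (r c) k (r t) = r⁻¹·bsplineDensity c k t` and `bsplineCDF (r c) k (r v) = bsplineCDF c k v` (RH-FREE; W1 of THETA-ASSIGN)

Cell `rh-explicit`, WEIL column, seat handoff-prove-2 gen12 (THETA-ASSIGN v1.0 §3 W1 «scaling»; interface `WeilColumnThetaWitness` p418783).
The CDF of the `(k+1)`-fold convolution of the uniform density on `[−c, c]` depends on `(c, v)` only through `v/c`.  This is the bridge the
arithmetic layer (cc-s2-1, W2/(AR)) uses to evaluate BOTH `P.Rtop` (`c = 1/m`) and `P.cut` (`c = η/(2m)`) with ONE Irwin–Hall polynomial.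
Nothing here bears on the truth of RH.
-/

noncomputable section

set_option linter.dupNamespace false

open Complex Set MeasureTheory Filter
open scoped Real Topology

namespace Summit.RiemannHypothesis.RiemannHypothesis.Theorems.WeilColumn.ThetaMellin

open Literature.NumberTheory.LFunctions ThetaParams

variable {r : ℝ}

/-- Scaling of the uniform density: `unif_{rc}(r u) = r⁻¹·unif_c(u)` for `r > 0`. -/
theorem unifDensity_scale (hr : 0 < r) (c u : ℝ) :
    unifDensity (r * c) (r * u) = (((r⁻¹ : ℝ)) : ℂ) * unifDensity c u := by
  rw [unifDensity_apply, unifDensity_apply]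
  have hiff : (r * u ∈ Icc (-(r * c)) (r * c)) ↔ (u ∈ Icc (-c) c) := by
    simp only [mem_Icc]
    constructor
    · rintro ⟨h1, h2⟩
      refine ⟨?_, le_of_mul_le_mul_left h2 hr⟩
      have h1' : r * (-c) ≤ r * u := by linarith
      exact le_of_mul_le_mul_left h1' hr
    · rintro ⟨h1, h2⟩
      exact ⟨by nlinarith, mul_le_mul_of_nonneg_left h2 hr.le⟩
  by_cases h : u ∈ Icc (-c) c
  · rw [if_pos (hiff.2 h), if_pos h]
    have hr0 : (r : ℂ) ≠ 0 := by exact_mod_cast hr.ne'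
    push_cast
    by_cases hc : c = 0
    · subst hc; simp
    · have hc0 : (c : ℂ) ≠ 0 := by exact_mod_cast hc
      field_simp
  · rw [if_neg (fun h' ↦ h (hiff.1 h')), if_neg h, mul_zero]

/-- **Density scaling**: `bsplineDensity (r c) k (r t) = r⁻¹·bsplineDensity c k t` for `r > 0` (induction; substitution `u = r v` in the
convolution). [folklore] -/
theorem bsplineDensity_scale (hr : 0 < r) (c : ℝ) : ∀ (k : ℕ) (t : ℝ),
    bsplineDensity (r * c) k (r * t) = (((r⁻¹ : ℝ)) : ℂ) * bsplineDensity c k t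
  | 0, t => unifDensity_scale hr c t
  | k + 1, t => by
      rw [bsplineDensity_succ_apply, bsplineDensity_succ_apply]
      set g : ℝ → ℂ := fun u ↦ unifDensity (r * c) u * bsplineDensity (r * c) k (r * t - u) with hg
      have hsub := Measure.integral_comp_mul_left g r
      -- `g (r v) = r⁻² · unif_c v · ρ_k (t − v)`
      have hgv : ∀ v : ℝ, g (r * v) = (((r⁻¹ : ℝ)) : ℂ) * (((r⁻¹ : ℝ)) : ℂ) * (unifDensity c v * bsplineDensity c k (t - v)) := by
        intro v
        simp only [hg]
        rw [show r * t - r * v = r * (t - v) by ring, unifDensity_scale hr, bsplineDensity_scale hr c k (t - v)]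
        ring
      have habs : |r⁻¹| = r⁻¹ := abs_of_pos (inv_pos.2 hr)
      rw [habs] at hsub
      simp_rw [hgv] at hsub
      rw [integral_const_mul] at hsub
      -- `hsub : r⁻¹·r⁻¹·∫(unif_c·ρ_k) = r⁻¹ • ∫ g`; solve for `∫ g`
      have hr0 : (r : ℂ) ≠ 0 := by exact_mod_cast hr.ne'
      change ∫ u, g u = _
      rw [Complex.real_smul] at hsub
      have : ∫ u, g u = (r : ℂ) * ((((r⁻¹ : ℝ)) : ℂ) * (((r⁻¹ : ℝ)) : ℂ) * ∫ v, unifDensity c v * bsplineDensity c k (t - v)) := by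
        rw [hsub]; push_cast; field_simp
      rw [this]; push_cast; field_simp

/-- Real form of the density scaling. -/
theorem bsplineDensity_re_scale (hr : 0 < r) (c : ℝ) (k : ℕ) (t : ℝ) :
    (bsplineDensity (r * c) k (r * t)).re = r⁻¹ * (bsplineDensity c k t).re := by
  rw [bsplineDensity_scale hr, Complex.re_ofReal_mul]

/-- **CDF scaling**: `bsplineCDF (r c) k (r v) = bsplineCDF c k v` for `r > 0`. [folklore] -/
theorem bsplineCDF_scale (hr : 0 < r) (c : ℝ) (k : ℕ) (v : ℝ) : bsplineCDF (r * c) k (r * v) = bsplineCDF c k v := by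
  unfold bsplineCDF
  rw [← integral_indicator measurableSet_Iic, ← integral_indicator measurableSet_Iic]
  set G : ℝ → ℝ := (Iic (r * v)).indicator fun t ↦ (bsplineDensity (r * c) k t).re with hG
  have hsub := Measure.integral_comp_mul_left G r
  have habs : |r⁻¹| = r⁻¹ := abs_of_pos (inv_pos.2 hr)
  have hGs : ∀ s : ℝ, G (r * s) = r⁻¹ * (Iic v).indicator (fun t ↦ (bsplineDensity c k t).re) s := by
    intro s
    simp only [hG, Set.indicator_apply, mem_Iic]
    have hiff : r * s ≤ r * v ↔ s ≤ v := mul_le_mul_iff_of_pos_left hr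
    by_cases h : s ≤ v
    · rw [if_pos (hiff.2 h), if_pos h, bsplineDensity_re_scale hr]
    · rw [if_neg (fun h' ↦ h (hiff.1 h')), if_neg h, mul_zero]
  rw [habs, smul_eq_mul] at hsub
  simp_rw [hGs] at hsub
  rw [integral_const_mul] at hsub
  -- `hsub : r⁻¹·∫ 1_{≤v}ρ_c = r⁻¹·∫ G`
  have hr1 : r⁻¹ ≠ 0 := inv_ne_zero hr.ne'
  have := mul_left_cancel₀ hr1 hsub
  exact this.symm

/-- The top-layer profile in Irwin–Hall currency: `P.Rtop τ = 1 − bsplineCDF c (m−1) (c·m·(1 − τ))` for ANY `c > 0`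
(so the checker may evaluate it with its preferred scale). -/
theorem Rtop_eq_of_scale (P : ThetaParams) (hm : 1 ≤ P.m) {c : ℝ} (hc : 0 < c) (τ : ℝ) :
    P.Rtop τ = 1 - bsplineCDF c (P.m - 1) (c * P.m * (1 - τ)) := by
  have hm0 : (0 : ℝ) < P.m := Nat.cast_pos.2 (by omega)
  unfold Rtop
  have h := bsplineCDF_scale (r := c * P.m) (by positivity) (1 / P.m) (P.m - 1) (1 - τ)
  rw [show c * (P.m : ℝ) * (1 / P.m) = c by field_simp] at h
  rw [h]

/-- The cut in Irwin–Hall currency: `P.cut x = bsplineCDF c (m−1) (c·(2m/η)·(x + a − η/2))` for ANY `c > 0` (`η > 0`). -/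
theorem cut_eq_of_scale (P : ThetaParams) (hm : 1 ≤ P.m) (hη : 0 < P.η) {c : ℝ} (hc : 0 < c) (x : ℝ) :
    P.cut x = bsplineCDF c (P.m - 1) (c * (2 * P.m / P.η) * (x + P.a - P.η / 2)) := by
  have hm0 : (0 : ℝ) < P.m := Nat.cast_pos.2 (by omega)
  unfold cut
  have h := bsplineCDF_scale (r := c * (2 * P.m / P.η)) (by positivity) (P.η / (2 * P.m)) (P.m - 1) (x + P.a - P.η / 2)
  rw [show c * (2 * (P.m : ℝ) / P.η) * (P.η / (2 * P.m)) = c by field_simp] at h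
  rw [h]

end Summit.RiemannHypothesis.RiemannHypothesis.Theorems.WeilColumn.ThetaMellin

end
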